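import Literature.AlgebraicGeometry.Motives.AbelianVarietyDualQuotient
import Literature.AlgebraicGeometry.Motives.AbelianVarietyTranslationInvariantAmple
import HarnessLib

/-!
# Translation actions of finite subgroups on abelian varieties, as `ActionOver` data

Layer `Literature/AlgebraicGeometry/Motives`, namespace
`Literature.AlgebraicGeometry.Motives.AbelianVariety`. Mumford, *Abelian Varieties* §7 Thm. 4
(p. 72): a finite subgroup `K ⊂ X(k)` acts on `X` by translations and `X → X/K` is the quotient;
Milne, *Abelian Varieties* I §8 (p. 40): "the action of `K(L)` on the second factor of `A × A`".
This file packages these actions as the homomorphisms `Δ →* Aut` and the `RelativeSpec.ActionOver`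
data consumed by the tree's finite-quotient and descent machinery
(`Motives/FiniteQuotientRecognition`, `RelativeSpec/EquivariantModuleDescent` (T1),
`…RankDescent` (β), `…DescentUnique` (T2)); the quotient THEOREMS are in the sequels
`Motives/AbelianVarietyIsogenyGeometricQuotient` (any complex isogeny) and
`Motives/AbelianVarietyDualQuotientAction` (`1 × φ_Θ`).

* §0 (any field `K`, `L`-points) points of `A × B`: `prodPoints_ext`, `mul_comp_fst/snd`,
  `one_comp_fst/snd`, the point `inrPoint A B g = (1, g)` and the homomorphism
  `inrPoints A B : B(L) →* (A × B)(L)`; TRANSLATIONS AS HOMOMORPHISMS: `translationAut A : A(K) →*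
  Aut_K(A)` (`P ↦ t_P`, the tree's `translationIso`), `secondTranslationAut A B : B(K) →*
  Aut_K(A × B)` (`g ↦ t_{(1,g)} = 1 × t_g`; `t_{(1,g)} ≫ p₁ = p₁`, `t_{(1,g)} ≫ p₂ = p₂ ≫ t_g`,
  `z ≫ t_{(1,g)} = (1,g) · z`; the bridge `whiskerLeft_translation : A.X ◁ t_g = t_{(1,g)}`);
* §1 (any field) the KERNEL TRANSLATIONS of a homomorphism `f : A → B`: `kerTranslationAut f :
  Ker f(K) →* Aut_K(A)`, invariance `t_x ≫ f = f` (`kerTranslationAut_hom_comp`), and the action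
  datum `kerTranslationActionOver f : ActionOver f (Ker f(K))` (`(ρ.aut x).hom = t_x`, `rfl`);
* §2 (over `ℂ`, `Θ` ample) the `K(Θ)`-ACTION ON `A × A`: `kThetaAut : K(Θ) →* Aut_ℂ(A × A)`,
  invariance `t_{(1,g)} ≫ (1 × φ_Θ) = 1 × φ_Θ` (`kThetaAut_hom_comp_oneProdPhiTheta`, from
  `Ker φ_Θ(ℂ) = K(Θ)`), the action datum `kThetaActionOver hΘ : ActionOver (1 × φ_Θ) K(Θ)`
  (`(ρ.aut g).hom = t_{(1,g)}` on the scheme `A × A`, `rfl`; `kThetaActionOver_act` unfolds the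
  action on sections to `t_{(1,g⁻¹)}♯`), `finite_kTheta_subtype`, `isAffineHom_oneProdPhiTheta`,
  `inrPoint_ne_one`;
* §3 the `K(Θ)`-ACTION ON `A` over `Â` (the quotient `φ_Θ` itself): `kThetaBaseAut`, invariance
  `t_g ≫ φ_Θ = φ_Θ`, `kThetaBaseActionOver hΘ : ActionOver φ_Θ K(Θ)` (`(ρ.aut g).hom = t_g`, `rfl`),
  `isAffineHom_phiTheta` — the datum for descending along the slices `{a} × A → {a} × Â`.

Definitions carry bodies; everything else is proved; no named fact, no instance, no `sorry`.

## References

* [MumfordAV1970] D. Mumford, *Abelian Varieties* (1970), §6 Application 1 (p. 60), §7 Thm. 4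
  (p. 72).
* [MilneAV2008] J. S. Milne, *Abelian Varieties* (2008), I §8 (p. 40).
* [GortzWedhorn2023] U. Görtz, T. Wedhorn, *Algebraic Geometry II* (2023), Def./Rem. 27.1
  (p. 799), (27.1.1) (p. 800).
-/

noncomputable section

universe u

open CategoryTheory CategoryTheory.Limits AlgebraicGeometry MonoidalCategory
open Literature.AlgebraicGeometry.RelativeSpec

namespace Literature.AlgebraicGeometry.Motives

namespace AbelianVariety

open scoped MonObj Obj

/-! ### §0 Points of `A × B`; translations as homomorphisms into `Aut` -/

section Points

variable {K : Type u} [Field K] (A B : AbelianVariety K) {L : Type u} [Field L] [Algebra K L]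

/-- Points of `A × B` are determined by their two coordinates.
[cite: GortzWedhorn2023, Def./Rem. 27.1 (p. 799)] -/
theorem prodPoints_ext {z w : (A.prod B).Points L}
    (h₁ : z ≫ (AbelianVariety.fst A B).hom.hom.hom = w ≫ (AbelianVariety.fst A B).hom.hom.hom)
    (h₂ : z ≫ (AbelianVariety.snd A B).hom.hom.hom = w ≫ (AbelianVariety.snd A B).hom.hom.hom) :
    z = w :=
  CartesianMonoidalCategory.hom_ext _ _ h₁ h₂

/-- The first coordinate is multiplicative on points of `A × B`.
[cite: GortzWedhorn2023, Def./Rem. 27.1 (p. 799)] -/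
theorem mul_comp_fst (z w : (A.prod B).Points L) :
    (z * w) ≫ (AbelianVariety.fst A B).hom.hom.hom =
      (z ≫ (AbelianVariety.fst A B).hom.hom.hom) * (w ≫ (AbelianVariety.fst A B).hom.hom.hom) :=
  MonObj.mul_comp z w _

/-- The second coordinate is multiplicative on points of `A × B`.
[cite: GortzWedhorn2023, Def./Rem. 27.1 (p. 799)] -/
theorem mul_comp_snd (z w : (A.prod B).Points L) :
    (z * w) ≫ (AbelianVariety.snd A B).hom.hom.hom =
      (z ≫ (AbelianVariety.snd A B).hom.hom.hom) * (w ≫ (AbelianVariety.snd A B).hom.hom.hom) :=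
  MonObj.mul_comp z w _

/-- The first coordinate of the unit point is the unit.
[cite: GortzWedhorn2023, Def./Rem. 27.1 (p. 799)] -/
theorem one_comp_fst : (1 : (A.prod B).Points L) ≫ (AbelianVariety.fst A B).hom.hom.hom = 1 :=
  MonObj.one_comp _

/-- The second coordinate of the unit point is the unit.
[cite: GortzWedhorn2023, Def./Rem. 27.1 (p. 799)] -/
theorem one_comp_snd : (1 : (A.prod B).Points L) ≫ (AbelianVariety.snd A B).hom.hom.hom = 1 :=
  MonObj.one_comp _

/-- The point `(1, g)` of `A × B`. [cite: GortzWedhorn2023, Def./Rem. 27.1 (p. 799)] -/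
def inrPoint (g : B.Points L) : (A.prod B).Points L :=
  CartesianMonoidalCategory.lift (1 : A.Points L) g

/-- `(1, g) ≫ p₁ = 1`. [cite: GortzWedhorn2023, Def./Rem. 27.1 (p. 799)] -/
@[simp]
theorem inrPoint_comp_fst (g : B.Points L) :
    inrPoint A B g ≫ (AbelianVariety.fst A B).hom.hom.hom = 1 :=
  CartesianMonoidalCategory.lift_fst _ _

/-- `(1, g) ≫ p₂ = g`. [cite: GortzWedhorn2023, Def./Rem. 27.1 (p. 799)] -/
@[simp]
theorem inrPoint_comp_snd (g : B.Points L) :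
    inrPoint A B g ≫ (AbelianVariety.snd A B).hom.hom.hom = g :=
  CartesianMonoidalCategory.lift_snd _ _

/-- The embedding of `B(L)` as the second factor of `(A × B)(L)`: `g ↦ (1, g)`, a group
homomorphism. [cite: GortzWedhorn2023, Def./Rem. 27.1 (p. 799)] -/
def inrPoints : B.Points L →* (A.prod B).Points L where
  toFun := inrPoint A B
  map_one' := prodPoints_ext A B (by rw [inrPoint_comp_fst, one_comp_fst])
    (by rw [inrPoint_comp_snd, one_comp_snd])
  map_mul' g g' := prodPoints_ext A B
    (by rw [inrPoint_comp_fst, mul_comp_fst, inrPoint_comp_fst, inrPoint_comp_fst, mul_one])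
    (by rw [inrPoint_comp_snd, mul_comp_snd, inrPoint_comp_snd, inrPoint_comp_snd])

/-- `inrPoints g = (1, g)`. [cite: GortzWedhorn2023, Def./Rem. 27.1 (p. 799)] -/
theorem inrPoints_apply (g : B.Points L) : inrPoints A B g = inrPoint A B g := rfl

/-- `inrPoints` is injective. [cite: GortzWedhorn2023, Def./Rem. 27.1 (p. 799)] -/
theorem inrPoints_injective : Function.Injective (inrPoints A B (L := L)) := fun g g' h => by
  rw [← inrPoint_comp_snd A B g, ← inrPoint_comp_snd A B g', ← inrPoints_apply,
    ← inrPoints_apply, h]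

end Points

section TranslationAut

variable {K : Type u} [Field K] (A B : AbelianVariety K)

/-- **Translations as a homomorphism `A(K) →* Aut_K(A)`**: `P ↦ t_P` (the tree's `translationIso`;
`t_P ∘ t_Q = t_{PQ}`, `t_1 = 1`; Görtz–Wedhorn II, Def./Rem. 27.1).
[cite: GortzWedhorn2023, Def./Rem. 27.1 (p. 799)] -/
def translationAut : A.Points K →* Aut A.X where
  toFun := A.translationIso
  map_one' := Iso.ext (by rw [translationIso_hom, translation_one]; rfl)
  map_mul' P Q := Iso.ext (by
    rw [CategoryTheory.Aut.Aut_mul_def, Iso.trans_hom, translationIso_hom, translationIso_hom,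
      translationIso_hom, translation_comp])

/-- `(translationAut P).hom = t_P`. [cite: GortzWedhorn2023, Def./Rem. 27.1 (p. 799)] -/
@[simp]
theorem translationAut_hom (P : A.Points K) : (A.translationAut P).hom = A.translation P := rfl

/-- `(translationAut P).inv = t_{P⁻¹}`. [cite: GortzWedhorn2023, Def./Rem. 27.1 (p. 799)] -/
@[simp]
theorem translationAut_inv (P : A.Points K) : (A.translationAut P).inv = A.translation P⁻¹ := rfl

/-- **Translations of `A × B` along the second factor**: `g ↦ t_{(1, g)} = 1 × t_g`, as a
homomorphism `B(K) →* Aut_K(A × B)`. [cite: GortzWedhorn2023, Def./Rem. 27.1 (p. 799)] -/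
def secondTranslationAut : B.Points K →* Aut (A.prod B).X :=
  (A.prod B).translationAut.comp (inrPoints A B)

/-- `(secondTranslationAut g).hom = t_{(1, g)}`.
[cite: GortzWedhorn2023, Def./Rem. 27.1 (p. 799)] -/
@[simp]
theorem secondTranslationAut_hom (g : B.Points K) :
    (secondTranslationAut A B g).hom = (A.prod B).translation (inrPoint A B g) := rfl

/-- `t_{(1,g)} ≫ p₁ = p₁`: a second-factor translation does not move the first coordinate.
[cite: GortzWedhorn2023, Def./Rem. 27.1 (p. 799)] -/
theorem secondTranslationAut_hom_comp_fst (g : B.Points K) :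
    (secondTranslationAut A B g).hom ≫ (AbelianVariety.fst A B).hom.hom.hom =
      (AbelianVariety.fst A B).hom.hom.hom := by
  rw [secondTranslationAut_hom, AbelianVariety.translation_comp_hom (AbelianVariety.fst A B),
    inrPoint_comp_fst, translation_one]
  exact Category.comp_id _

/-- `t_{(1,g)} ≫ p₂ = p₂ ≫ t_g`. [cite: GortzWedhorn2023, Def./Rem. 27.1 (p. 799)] -/
theorem secondTranslationAut_hom_comp_snd (g : B.Points K) :
    (secondTranslationAut A B g).hom ≫ (AbelianVariety.snd A B).hom.hom.hom =
      (AbelianVariety.snd A B).hom.hom.hom ≫ B.translation g := by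
  rw [secondTranslationAut_hom, AbelianVariety.translation_comp_hom (AbelianVariety.snd A B),
    inrPoint_comp_snd]

/-- On points: `z ≫ t_{(1,g)} = (1, g) · z`. [cite: GortzWedhorn2023, Def./Rem. 27.1 (p. 799)] -/
theorem comp_secondTranslationAut_hom (g : B.Points K) (z : (A.prod B).Points K) :
    z ≫ (secondTranslationAut A B g).hom = inrPoint A B g * z := by
  rw [secondTranslationAut_hom]
  exact (A.prod B).comp_translation z _

/-- **`1 × t_g = t_{(1,g)}`**: the left whiskering of the translation `t_g` of `B` by `A` is the
translation of the product `A × B` by the point `(1, g)` (both have first coordinate `p₁` and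
second coordinate `p₂ ≫ t_g`). This identifies the two spellings of "the action of `G ≤ B(K)` on
the second factor of `A × B`" (`X ◁ t_g` as in `Modules/EquivariantStructure` consumers, and
`secondTranslationAut`). [cite: GortzWedhorn2023, Def./Rem. 27.1 (p. 799)] -/
theorem whiskerLeft_translation (g : B.Points K) :
    A.X ◁ B.translation g = (A.prod B).translation (inrPoint A B g) := by
  apply CartesianMonoidalCategory.hom_ext
  · rw [CartesianMonoidalCategory.whiskerLeft_fst]
    exact (secondTranslationAut_hom_comp_fst A B g).symm
  · rw [CartesianMonoidalCategory.whiskerLeft_snd]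
    exact (secondTranslationAut_hom_comp_snd A B g).symm

/-- The same on underlying schemes: `(1 × t_g).left = (secondTranslationAut A B g).hom.left`.
[cite: GortzWedhorn2023, Def./Rem. 27.1 (p. 799)] -/
theorem whiskerLeft_translation_left (g : B.Points K) :
    (A.X ◁ B.translation g).left = (secondTranslationAut A B g).hom.left := by
  rw [whiskerLeft_translation]; rfl

end TranslationAut

/-! ### §1 Kernel translations of a homomorphism -/

section KerTranslation

variable {K : Type u} [Field K] {A B : AbelianVariety K} (f : A ⟶ B)

/-- **The kernel `Ker f(K)` acts on `A` by translations**: `x ↦ t_x`, a homomorphism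
`Ker f(K) →* Aut_K(A)` (Mumford §7 Thm. 4: the finite subgroup `K` acting by translations).
[cite: MumfordAV1970, §7 Thm. 4 (p. 72)] -/
def kerTranslationAut : ↥(Hom.kerPoints (specOver K K) f) →* Aut A.X :=
  A.translationAut.comp (Hom.kerPoints (specOver K K) f).subtype

/-- `(kerTranslationAut f x).hom = t_x`. [cite: GortzWedhorn2023, Def./Rem. 27.1 (p. 799)] -/
@[simp]
theorem kerTranslationAut_hom (x : Hom.kerPoints (specOver K K) f) :
    (kerTranslationAut f x).hom = A.translation (x : A.Points K) := rfl

/-- A kernel point is killed by `f`: `x ≫ f = 1`. [cite: GortzWedhorn2023, (27.1.1) (p. 800)] -/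
theorem coe_comp_eq_one (x : Hom.kerPoints (specOver K K) f) :
    (x : A.Points K) ≫ f.hom.hom.hom = 1 :=
  (Hom.mem_kerPoints_iff f (x : A.Points K)).mp x.2

/-- **Invariance**: `t_x ≫ f = f` for `x ∈ Ker f` (`f` is a homomorphism: `t_x ≫ f = f ≫ t_{f x}`
and `f x = 1`). [cite: MumfordAV1970, §7 Thm. 4 (p. 72)] -/
theorem kerTranslationAut_hom_comp (x : Hom.kerPoints (specOver K K) f) :
    (kerTranslationAut f x).hom ≫ f.hom.hom.hom = f.hom.hom.hom := by
  rw [kerTranslationAut_hom, AbelianVariety.translation_comp_hom f, coe_comp_eq_one,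
    translation_one]
  exact Category.comp_id _

/-- On points: `z ≫ t_x = x · z`. [cite: GortzWedhorn2023, Def./Rem. 27.1 (p. 799)] -/
theorem comp_kerTranslationAut_hom (x : Hom.kerPoints (specOver K K) f) (z : A.Points K) :
    z ≫ (kerTranslationAut f x).hom = (x : A.Points K) * z := by
  rw [kerTranslationAut_hom]
  exact A.comp_translation z _

end KerTranslation

section KerTranslationAction

variable {K : Type u} [Field K] {A B : AbelianVariety K} (f : A ⟶ B)

/-- **The translation action of `Ker f(K)` on `A` over `B`** — the action datum
`ρ : ActionOver p G` of the descent theorems with `p = f` (underlying scheme map), `G = Ker f(K)`,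
`ρ.aut x = t_x` on the scheme `A` (Mumford §7 Thm. 4: `X/K` for the finite subgroup `K` acting
by translations). [cite: MumfordAV1970, §7 Thm. 4 (p. 72)] -/
def kerTranslationActionOver :
    ActionOver (Hom.toSchemeHom f) ↥(Hom.kerPoints (specOver K K) f) where
  aut := ((Over.forget _).mapAut A.X).comp (kerTranslationAut f)
  aut_comp x := congrArg CommaMorphism.left (kerTranslationAut_hom_comp f x)

/-- `(ρ.aut x).hom = t_x` on the scheme `A`. [cite: GortzWedhorn2023, Def./Rem. 27.1 (p. 799)] -/
@[simp]
theorem kerTranslationActionOver_aut_hom (x : Hom.kerPoints (specOver K K) f) :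
    ((kerTranslationActionOver f).aut x).hom = (A.translation (x : A.Points K)).left := rfl

/-- The action on sections of `kerTranslationActionOver` is pull-back along `t_{x⁻¹}`
(unfolding `ActionOver.act`). [cite: GortzWedhorn2023, Def./Rem. 27.1 (p. 799)] -/
theorem kerTranslationActionOver_act (x : Hom.kerPoints (specOver K K) f) (V : B.X.left.Opens)
    (b : Γ(A.X.left, Hom.toSchemeHom f ⁻¹ᵁ V)) :
    (kerTranslationActionOver f).act x V b =
      (A.translation ((x : A.Points K)⁻¹)).left.appLE (Hom.toSchemeHom f ⁻¹ᵁ V)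
        (Hom.toSchemeHom f ⁻¹ᵁ V) ((kerTranslationActionOver f).preimage_preimage x⁻¹ V).ge b :=
  rfl

end KerTranslationAction

/-! ### §2 The `K(Θ)`-action on `A × A` over `A × Â` -/

section KTheta

variable (A : AbelianVariety ℂ) {Θ : CartierDivisor A.X.left} (hΘ : Θ.IsAmple)

/-- **The action of `K(Θ) ⊆ A(ℂ)` on `A × A` by `g ↦ 1 × t_g`**, as a homomorphism into the
`ℂ`-automorphisms of `A × A` (Milne, *Abelian Varieties* I §8 p. 40: "the action of `K(L)` on the
second factor of `A × A`"). [cite: MilneAV2008, I §8 (p. 40)] -/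
def kThetaAut (Θ : CartierDivisor A.X.left) : ↥(A.KTheta Θ) →* Aut (A.prod A).X :=
  (secondTranslationAut A A).comp (A.KTheta Θ).subtype

/-- `(kThetaAut g).hom = t_{(1, g)}`. [cite: MilneAV2008, I §8 (p. 40)] -/
@[simp]
theorem kThetaAut_hom (g : A.KTheta Θ) :
    (A.kThetaAut Θ g).hom = (A.prod A).translation (inrPoint A A (g : A.Points ℂ)) := rfl

/-- `kThetaAut g = secondTranslationAut g`. [cite: MilneAV2008, I §8 (p. 40)] -/
theorem kThetaAut_apply (g : A.KTheta Θ) :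
    A.kThetaAut Θ g = secondTranslationAut A A (g : A.Points ℂ) := rfl

/-- A point of `K(Θ)` is killed by `φ_Θ`: `g ≫ φ_Θ = 1`. [cite: MilneAV2008, I §8 (p. 40)] -/
theorem coe_comp_phiTheta (g : A.KTheta Θ) :
    (g : A.Points ℂ) ≫ (A.phiTheta Θ hΘ).hom.hom.hom = 1 := by
  have h : (g : A.Points ℂ) ∈
      (IsMonHom.monoidHom (A.phiTheta Θ hΘ).hom.hom.hom (specOver ℂ ℂ)).ker := by
    rw [ker_monoidHom_phiTheta]; exact g.2
  exact h

/-- The first coordinate of `1 × φ_Θ` is the first coordinate. [cite: MilneAV2008, I §8 (p. 40)] -/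
theorem oneProdPhiTheta_comp_fst :
    (A.oneProdPhiTheta hΘ).hom.hom.hom ≫ (AbelianVariety.fst A (A.dualOf Θ hΘ)).hom.hom.hom =
      (AbelianVariety.fst A A).hom.hom.hom := by
  have h : A.oneProdPhiTheta hΘ ≫ AbelianVariety.fst A (A.dualOf Θ hΘ) =
      AbelianVariety.fst A A := by
    rw [oneProdPhiTheta, prodMap_fst, Category.comp_id]
  exact congrArg (fun f => f.hom.hom.hom) h

/-- The second coordinate of `1 × φ_Θ` is `p₂ ≫ φ_Θ`. [cite: MilneAV2008, I §8 (p. 40)] -/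
theorem oneProdPhiTheta_comp_snd :
    (A.oneProdPhiTheta hΘ).hom.hom.hom ≫ (AbelianVariety.snd A (A.dualOf Θ hΘ)).hom.hom.hom =
      (AbelianVariety.snd A A).hom.hom.hom ≫ (A.phiTheta Θ hΘ).hom.hom.hom := by
  have h : A.oneProdPhiTheta hΘ ≫ AbelianVariety.snd A (A.dualOf Θ hΘ) =
      AbelianVariety.snd A A ≫ A.phiTheta Θ hΘ := by
    rw [oneProdPhiTheta, prodMap_snd]
  exact congrArg (fun f => f.hom.hom.hom) h

/-- `(1, g)` lies in the kernel of `1 × φ_Θ` for `g ∈ K(Θ)`. [cite: MilneAV2008, I §8 (p. 40)] -/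
theorem inrPoint_comp_oneProdPhiTheta (g : A.KTheta Θ) :
    inrPoint A A (g : A.Points ℂ) ≫ (A.oneProdPhiTheta hΘ).hom.hom.hom = 1 := by
  apply prodPoints_ext A (A.dualOf Θ hΘ)
  · rw [Category.assoc, oneProdPhiTheta_comp_fst, inrPoint_comp_fst, one_comp_fst]
  · rw [Category.assoc, oneProdPhiTheta_comp_snd, ← Category.assoc, inrPoint_comp_snd,
      coe_comp_phiTheta, one_comp_snd]

/-- **`1 × φ_Θ` is invariant under the `K(Θ)`-translations**: `t_{(1,g)} ≫ (1 × φ_Θ) = 1 × φ_Θ`.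
[cite: MilneAV2008, I §8 (p. 40)] -/
theorem kThetaAut_hom_comp_oneProdPhiTheta (g : A.KTheta Θ) :
    (A.kThetaAut Θ g).hom ≫ (A.oneProdPhiTheta hΘ).hom.hom.hom =
      (A.oneProdPhiTheta hΘ).hom.hom.hom := by
  rw [kThetaAut_hom, AbelianVariety.translation_comp_hom (A.oneProdPhiTheta hΘ),
    inrPoint_comp_oneProdPhiTheta, translation_one]
  exact Category.comp_id _

end KTheta

section KThetaAction

variable (A : AbelianVariety ℂ) {Θ : CartierDivisor A.X.left} (hΘ : Θ.IsAmple)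

include hΘ in
/-- `K(Θ)` is finite for `Θ` ample (the tree's `finite_KTheta`).
[cite: MumfordAV1970, §6 Application 1 (p. 60)] -/
theorem finite_kTheta_subtype : Finite ↥(A.KTheta Θ) :=
  (A.finite_KTheta hΘ).to_subtype

/-- **`1 × φ_Θ` is an affine morphism** (an isogeny is finite).
[cite: MumfordAV1970, §7 Thm. 4 (p. 72)] -/
theorem isAffineHom_oneProdPhiTheta : IsAffineHom (Hom.toSchemeHom (A.oneProdPhiTheta hΘ)) :=
  haveI := (A.isIsogeny_oneProdPhiTheta hΘ).2
  inferInstance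

/-- **The `K(Θ)`-action on `A × A` over `A × Â`** (the action datum `ρ : ActionOver p G` of the
descent theorems `RelativeSpec/EquivariantModuleDescent`, `…RankDescent`, with `p = 1 × φ_Θ`,
`G = K(Θ)`, `ρ.aut g = 1 × t_g` on the scheme `A × A`): Milne, *Abelian Varieties* I §8 p. 40, "the
action of `K(L)` on the second factor of `A × A` … corresponds by (8.13) to a sheaf `𝒫` on
`A × A^∨`". [cite: MilneAV2008, I §8 (p. 40)] -/
def kThetaActionOver : ActionOver (Hom.toSchemeHom (A.oneProdPhiTheta hΘ)) ↥(A.KTheta Θ) where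
  aut := ((Over.forget _).mapAut (A.prod A).X).comp (A.kThetaAut Θ)
  aut_comp g := congrArg CommaMorphism.left (A.kThetaAut_hom_comp_oneProdPhiTheta hΘ g)

/-- The automorphisms of `kThetaActionOver` are the underlying scheme maps of `kThetaAut`.
[cite: MilneAV2008, I §8 (p. 40)] -/
theorem kThetaActionOver_aut :
    (A.kThetaActionOver hΘ).aut = ((Over.forget _).mapAut (A.prod A).X).comp (A.kThetaAut Θ) := rfl

/-- `(ρ.aut g).hom = t_{(1,g)}` on the scheme `A × A`. [cite: MilneAV2008, I §8 (p. 40)] -/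
@[simp]
theorem kThetaActionOver_aut_hom (g : A.KTheta Θ) :
    ((A.kThetaActionOver hΘ).aut g).hom =
      ((A.prod A).translation (inrPoint A A (g : A.Points ℂ))).left := rfl

/-- The action on sections of `kThetaActionOver` is pull-back along `t_{(1, g⁻¹)}` (unfolding
`ActionOver.act`). [cite: MilneAV2008, I §8 (p. 40)] -/
theorem kThetaActionOver_act (g : A.KTheta Θ) (V : (A.prod (A.dualOf Θ hΘ)).X.left.Opens)
    (b : Γ((A.prod A).X.left, Hom.toSchemeHom (A.oneProdPhiTheta hΘ) ⁻¹ᵁ V)) :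
    (A.kThetaActionOver hΘ).act g V b =
      ((A.prod A).translation (inrPoint A A ((g : A.Points ℂ)⁻¹))).left.appLE
        (Hom.toSchemeHom (A.oneProdPhiTheta hΘ) ⁻¹ᵁ V)
        (Hom.toSchemeHom (A.oneProdPhiTheta hΘ) ⁻¹ᵁ V)
        ((A.kThetaActionOver hΘ).preimage_preimage g⁻¹ V).ge b := rfl

/-- `(1, g) ≠ 1` for `g ≠ 1`. [cite: GortzWedhorn2023, Def./Rem. 27.1 (p. 799)] -/
theorem inrPoint_ne_one {g : A.Points ℂ} (hg : g ≠ 1) : inrPoint A A g ≠ 1 := fun h => hg <| by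
  have h' : inrPoints A A g = inrPoints A A 1 := by rw [inrPoints_apply, h, map_one]
  exact inrPoints_injective A A h'

end KThetaAction

/-! ### §3 The `K(Θ)`-action on `A` over `Â` (the quotient `φ_Θ : A → Â = A/K(Θ)` itself) -/

section KThetaBase

variable (A : AbelianVariety ℂ) {Θ : CartierDivisor A.X.left} (hΘ : Θ.IsAmple)

/-- **The action of `K(Θ) ⊆ A(ℂ)` on `A` by translations**, `g ↦ t_g`, as a homomorphism into
`Aut_ℂ(A)` (Milne I §8 p. 40: `A^∨ := A/K(L)`). [cite: MilneAV2008, I §8 (p. 40)] -/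
def kThetaBaseAut (Θ : CartierDivisor A.X.left) : ↥(A.KTheta Θ) →* Aut A.X :=
  A.translationAut.comp (A.KTheta Θ).subtype

/-- `(kThetaBaseAut g).hom = t_g`. [cite: MilneAV2008, I §8 (p. 40)] -/
@[simp]
theorem kThetaBaseAut_hom (g : A.KTheta Θ) :
    (A.kThetaBaseAut Θ g).hom = A.translation (g : A.Points ℂ) := rfl

/-- **`φ_Θ` is invariant under the `K(Θ)`-translations**: `t_g ≫ φ_Θ = φ_Θ`
(`g ∈ K(Θ) = Ker φ_Θ(ℂ)`). [cite: MilneAV2008, I §8 (p. 40)] -/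
theorem kThetaBaseAut_hom_comp_phiTheta (g : A.KTheta Θ) :
    (A.kThetaBaseAut Θ g).hom ≫ (A.phiTheta Θ hΘ).hom.hom.hom = (A.phiTheta Θ hΘ).hom.hom.hom := by
  rw [kThetaBaseAut_hom, AbelianVariety.translation_comp_hom (A.phiTheta Θ hΘ), coe_comp_phiTheta,
    translation_one]
  exact Category.comp_id _

/-- On points: `z ≫ t_g = g · z`. [cite: GortzWedhorn2023, Def./Rem. 27.1 (p. 799)] -/
theorem comp_kThetaBaseAut_hom (g : A.KTheta Θ) (z : A.Points ℂ) :
    z ≫ (A.kThetaBaseAut Θ g).hom = (g : A.Points ℂ) * z := by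
  rw [kThetaBaseAut_hom]
  exact A.comp_translation z _

/-- **`φ_Θ` is an affine morphism** (an isogeny is finite).
[cite: MumfordAV1970, §7 Thm. 4 (p. 72)] -/
theorem isAffineHom_phiTheta : IsAffineHom (Hom.toSchemeHom (A.phiTheta Θ hΘ)) :=
  haveI := (A.isIsogeny_phiTheta hΘ).2
  inferInstance

/-- **The `K(Θ)`-action on `A` over `Â = A/K(Θ)`** (action datum over the quotient map `φ_Θ`
itself; `(ρ.aut g).hom = t_g` on the scheme `A`). [cite: MilneAV2008, I §8 (p. 40)] -/
def kThetaBaseActionOver : ActionOver (Hom.toSchemeHom (A.phiTheta Θ hΘ)) ↥(A.KTheta Θ) where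
  aut := ((Over.forget _).mapAut A.X).comp (A.kThetaBaseAut Θ)
  aut_comp g := congrArg CommaMorphism.left (A.kThetaBaseAut_hom_comp_phiTheta hΘ g)

/-- The automorphisms of `kThetaBaseActionOver` are the underlying scheme maps of
`kThetaBaseAut`. [cite: MilneAV2008, I §8 (p. 40)] -/
theorem kThetaBaseActionOver_aut :
    (A.kThetaBaseActionOver hΘ).aut = ((Over.forget _).mapAut A.X).comp (A.kThetaBaseAut Θ) := rfl

/-- `(ρ.aut g).hom = t_g` on the scheme `A`. [cite: MilneAV2008, I §8 (p. 40)] -/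
@[simp]
theorem kThetaBaseActionOver_aut_hom (g : A.KTheta Θ) :
    ((A.kThetaBaseActionOver hΘ).aut g).hom = (A.translation (g : A.Points ℂ)).left := rfl

end KThetaBase

end AbelianVariety

end Literature.AlgebraicGeometry.Motives

end
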